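import Literature.MathematicalPhysics.StatisticalMechanics.PeriodicConfigurationSums
import Literature.MathematicalPhysics.StatisticalMechanics.LennardJonesClusters
import Literature.Geometry.DiscreteGeometry.KissingPatterns
import HarnessLib
import Summits.AtomisticToContinuum.Crystallization.Theorems.ChargedEnergyGap.Negative.BlocksBound
import Summits.AtomisticToContinuum.Crystallization.Theorems.ReggeStarCoercivityPeriodicStarCoercivityDefs

/-!
# `PeriodicStarCoercivity` (route `ReggeStarCoercivity`, stmt-AtomisticToContinuum-13602), line `pinned-equilibria-reduction`:
stub S1 `stub_frozenDescent` — frozen-status descent to pinned equilibria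

Registered stub (skeleton `Cruxes/PeriodicStarCoercivity/Lines/pinned_equilibria_reduction.lean`):
`∀ P : (PeriodicConfiguration 3), ∀ l : List (ℝ × ℝ), (∀ p ∈ l, 0 < p.1 ∧ 0 < p.2) → ∃ P' : (PeriodicConfiguration 3), e P' ≤ e P ∧ ndFrac P' = ndFrac P ∧
 fdFrac P' = fdFrac P ∧ ∀ p ∈ l, Equilibrated p.1 p.2 P'`
(vocabulary from `Theorems/ReggeStarCoercivityPeriodicStarCoercivityDefs.lean`; `Equilibrated ε ρ P` is the
VARIATIONAL `(ε, ρ)`-pinned equilibrium: no status-preserving sublattice move of size `< ρ` at a `ρ`-robust site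
lowers `#motif · e` by more than `ε ρ`, and — if the classification is `ρ`-metric-robust — no linear image with
`‖A − 1‖ < ρ` lowers `e` by more than `ε ρ`).

Proof: finite descent.  A violation of either clause hands over a configuration `P₂` whose motif is a
status-preserving bijective image of the motif of `P` (`s ↦ t`, the other sites fixed, for a move — `IsMove` forbids
orbit merging; `s ↦ A s` for a linear image — `A` is injective because `A(G)` is a full-rank lattice,
`injective_of_isLinImage`), so `#motif`, `ndFrac`, `fdFrac` are unchanged (`fracs_eq_of_statusBij`), while the
energy per particle drops by more than `ε ρ / #motif ≥ q := (min over the list of ε ρ)/#motif` (`descent_step`).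
Periodic Lennard-Jones energies per particle are bounded below (item 0714, landed:
`ChargedEnergyGapNegative.bddBelow_energyPerParticle_lennardJones`), so by induction on `k` with `e < floor + k q`
the descent reaches a configuration equilibrated for every pair of the list.  All `[folklore]`.
-/

noncomputable section

open scoped BigOperators Classical
open Literature.MathematicalPhysics.StatisticalMechanics Literature.Geometry.DiscreteGeometry

namespace Summit.AtomisticToContinuum.Crystallization.Theorems.ReggeStarCoercivityPeriodicStarCoercivity

/-! ## Fractions are carried along status-preserving bijections of motifs -/

/-- The motif is non-empty, so `#motif > 0` (as a real). -/
theorem motif_card_pos (P : (PeriodicConfiguration 3)) : 0 < (P.motif.card : ℝ) :=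
  Nat.cast_pos.2 (Finset.card_pos.2 P.motif_nonempty)

/-- The near-defective set as a single filter of the motif. -/
theorem nearDefSet_eq (Q : (PeriodicConfiguration 3)) :
    nearDefSet Q = Q.motif.filter fun x => ¬ IsFree Q x ∧ Near (7 / 100) Q x := by
  unfold nearDefSet defectSet
  rw [Finset.filter_filter]

/-- The far-defective set as a single filter of the motif. -/
theorem farDefSet_eq (Q : (PeriodicConfiguration 3)) :
    farDefSet Q = Q.motif.filter fun x => ¬ IsFree Q x ∧ ¬ Near (7 / 100) Q x := by
  unfold farDefSet defectSet
  rw [Finset.filter_filter]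

/-- A status-type predicate transported along a bijection of motifs keeps its count. -/
theorem card_filter_eq_of_bij {P P' : (PeriodicConfiguration 3)} (φ : (EuclideanSpace ℝ (Fin 3)) → (EuclideanSpace ℝ (Fin 3))) (hinj : Set.InjOn φ P.motif)
    (himg : P'.motif = P.motif.image φ) (p q : (EuclideanSpace ℝ (Fin 3)) → Prop) [DecidablePred p] [DecidablePred q]
    (hp : ∀ s ∈ P.motif, (p s ↔ q (φ s))) :
    (P'.motif.filter q).card = (P.motif.filter p).card := by
  rw [himg, Finset.filter_image, Finset.card_image_of_injOn]
  · congr 1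
    exact Finset.filter_congr fun s hs => (hp s hs).symm
  · exact hinj.mono (Finset.coe_subset.2 (Finset.filter_subset _ _))

/-- Motif size and both fractions are carried along a status-preserving bijection of motifs. -/
theorem fracs_eq_of_statusBij {P P' : (PeriodicConfiguration 3)} (φ : (EuclideanSpace ℝ (Fin 3)) → (EuclideanSpace ℝ (Fin 3))) (hinj : Set.InjOn φ P.motif)
    (himg : P'.motif = P.motif.image φ) (hst : ∀ s ∈ P.motif, SameStatus P s P' (φ s)) :
    P'.motif.card = P.motif.card ∧ ndFrac P' = ndFrac P ∧ fdFrac P' = fdFrac P := by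
  have hcard : P'.motif.card = P.motif.card := by rw [himg, Finset.card_image_of_injOn hinj]
  have hnd : (nearDefSet P').card = (nearDefSet P).card := by
    rw [nearDefSet_eq, nearDefSet_eq]
    refine card_filter_eq_of_bij φ hinj himg _ _ ?_
    intro s hs
    obtain ⟨h1, h2⟩ := hst s hs
    rw [h1, h2]
  have hfd : (farDefSet P').card = (farDefSet P).card := by
    rw [farDefSet_eq, farDefSet_eq]
    refine card_filter_eq_of_bij φ hinj himg _ _ ?_
    intro s hs
    obtain ⟨h1, h2⟩ := hst s hs
    rw [h1, h2]
  refine ⟨hcard, ?_, ?_⟩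
  · unfold ndFrac; rw [hnd, hcard]
  · unfold fdFrac; rw [hfd, hcard]

/-- A sublattice move at frozen statuses preserves motif size and both fractions. -/
theorem fracs_eq_of_move {P P' : (PeriodicConfiguration 3)} {s t : (EuclideanSpace ℝ (Fin 3))} (hs : s ∈ P.motif) (hm : IsMove P s t P')
    (h1 : SameStatus P s P' t) (h2 : ∀ s' ∈ P.motif, s' ≠ s → SameStatus P s' P' s') :
    P'.motif.card = P.motif.card ∧ ndFrac P' = ndFrac P ∧ fdFrac P' = fdFrac P := by
  obtain ⟨-, ht, hmotif⟩ := hm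
  let φ : (EuclideanSpace ℝ (Fin 3)) → (EuclideanSpace ℝ (Fin 3)) := fun x => if x = s then t else x
  have hφs : φ s = t := by simp [φ]
  have hφne : ∀ x, x ≠ s → φ x = x := fun x hx => by simp [φ, hx]
  refine fracs_eq_of_statusBij φ ?_ ?_ ?_
  · intro x hx y hy hxy
    by_cases hxs : x = s <;> by_cases hys : y = s
    · rw [hxs, hys]
    · rw [hxs, hφs, hφne y hys] at hxy
      exact absurd (hxy ▸ Finset.mem_erase.2 ⟨hys, hy⟩) ht
    · rw [hys, hφs, hφne x hxs] at hxy
      exact absurd (hxy.symm ▸ Finset.mem_erase.2 ⟨hxs, hx⟩) ht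
    · rwa [hφne x hxs, hφne y hys] at hxy
  · rw [hmotif]
    ext z
    simp only [Finset.mem_insert, Finset.mem_erase, Finset.mem_image]
    constructor
    · rintro (rfl | ⟨hzs, hz⟩)
      · exact ⟨s, hs, hφs⟩
      · exact ⟨z, hz, hφne z hzs⟩
    · rintro ⟨x, hx, rfl⟩
      by_cases hxs : x = s
      · left; rw [hxs, hφs]
      · right; rw [hφne x hxs]; exact ⟨hxs, hx⟩
  · intro x hx
    by_cases hxs : x = s
    · rw [hxs, hφs]; exact h1
    · rw [hφne x hxs]; exact h2 x hx hxs

/-- If a linear image of a periodic configuration is again periodic (with lattice `A(G)`), `A` is injective. -/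
theorem injective_of_isLinImage {P P'' : (PeriodicConfiguration 3)} {A : (EuclideanSpace ℝ (Fin 3)) →L[ℝ] (EuclideanSpace ℝ (Fin 3))} (h : IsLinImage P A P'') :
    Function.Injective A := by
  have hspan : Submodule.span ℝ (P''.lattice : Set (EuclideanSpace ℝ (Fin 3))) = ⊤ := P''.isZLattice.span_top
  rw [h.2] at hspan
  have himg : (A : (EuclideanSpace ℝ (Fin 3)) → (EuclideanSpace ℝ (Fin 3))) '' (P.lattice : Set (EuclideanSpace ℝ (Fin 3))) = (A : (EuclideanSpace ℝ (Fin 3)) →ₗ[ℝ] (EuclideanSpace ℝ (Fin 3))) '' (P.lattice : Set (EuclideanSpace ℝ (Fin 3))) := rfl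
  rw [himg, Submodule.span_image] at hspan
  have hsurj : Function.Surjective (A : (EuclideanSpace ℝ (Fin 3)) →ₗ[ℝ] (EuclideanSpace ℝ (Fin 3))) := by
    rw [← LinearMap.range_eq_top, eq_top_iff, ← hspan]
    exact LinearMap.map_le_range
  have hinj : Function.Injective (A : (EuclideanSpace ℝ (Fin 3)) →ₗ[ℝ] (EuclideanSpace ℝ (Fin 3))) := LinearMap.injective_iff_surjective.2 hsurj
  exact hinj

/-- A linear image at frozen statuses preserves motif size and both fractions. -/
theorem fracs_eq_of_linImage {P P'' : (PeriodicConfiguration 3)} {A : (EuclideanSpace ℝ (Fin 3)) →L[ℝ] (EuclideanSpace ℝ (Fin 3))} (h : IsLinImage P A P'')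
    (hst : ∀ s ∈ P.motif, SameStatus P s P'' (A s)) :
    P''.motif.card = P.motif.card ∧ ndFrac P'' = ndFrac P ∧ fdFrac P'' = fdFrac P :=
  fracs_eq_of_statusBij (fun x => A x) (injective_of_isLinImage h).injOn h.1 hst

/-! ## The descent -/

/-- A uniform floor for periodic Lennard-Jones energies per particle (item 0714, landed). -/
theorem exists_floor : ∃ B : ℝ, ∀ Q : (PeriodicConfiguration 3), B ≤ e Q := by
  obtain ⟨B, hB⟩ :=
    Summit.AtomisticToContinuum.Crystallization.Theorems.ChargedEnergyGapNegative.bddBelow_energyPerParticle_lennardJones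
  exact ⟨B, fun Q => hB ⟨Q, rfl⟩⟩

/-- A positive lower bound for the products `ε ρ` over a finite list of positive pairs. -/
theorem exists_min_prod (l : List (ℝ × ℝ)) (hl : ∀ p ∈ l, 0 < p.1 ∧ 0 < p.2) :
    ∃ δ : ℝ, 0 < δ ∧ ∀ p ∈ l, δ ≤ p.1 * p.2 := by
  induction l with
  | nil => exact ⟨1, one_pos, by simp⟩
  | cons p l ih =>
    obtain ⟨δ, hδ, h⟩ := ih (fun q hq => hl q (List.mem_cons_of_mem _ hq))
    have hp := hl p List.mem_cons_self
    refine ⟨min (p.1 * p.2) δ, lt_min (mul_pos hp.1 hp.2) hδ, ?_⟩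
    intro q hq
    rcases List.mem_cons.1 hq with rfl | hq
    · exact min_le_left _ _
    · exact (min_le_right _ _).trans (h q hq)

/-- **One descent step.** A configuration violating `(ε, ρ)`-equilibrium is replaced by one with the same motif
size and fractions and energy per cell lower by more than `ε ρ`. -/
theorem descent_step {P : (PeriodicConfiguration 3)} {ε ρ : ℝ} (hε : 0 < ε) (hρ : 0 < ρ) (h : ¬ Equilibrated ε ρ P) :
    ∃ P₂ : (PeriodicConfiguration 3), P₂.motif.card = P.motif.card ∧ ndFrac P₂ = ndFrac P ∧ fdFrac P₂ = fdFrac P ∧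
      ε * ρ < (P.motif.card : ℝ) * (e P - e P₂) := by
  unfold Equilibrated at h
  rw [not_and_or] at h
  rcases h with h | h
  · push Not at h
    obtain ⟨s, hs, hR, t, P', hd, hm, hlt⟩ := h
    obtain ⟨h1, h2⟩ := hR t P' hd hm
    obtain ⟨hc, hn, hf⟩ := fracs_eq_of_move hs hm h1 h2
    exact ⟨P', hc, hn, hf, hlt⟩
  · push Not at h
    obtain ⟨hMR, A, P'', hA, hli, hlt⟩ := h
    obtain ⟨hc, hn, hf⟩ := fracs_eq_of_linImage hli (hMR A P'' hA hli)
    refine ⟨P'', hc, hn, hf, ?_⟩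
    have hn1 : (1 : ℝ) ≤ P.motif.card := by exact_mod_cast Finset.card_pos.2 P.motif_nonempty
    have hpos : 0 < e P - e P'' := by nlinarith [mul_pos hε hρ]
    nlinarith

/-- **Stub S1 `stub_frozenDescent` of the line `pinned-equilibria-reduction`** (crux
`ReggeStarCoercivity.PeriodicStarCoercivity`, stmt-AtomisticToContinuum-13602): every periodic configuration can
be replaced, for any finite list of positive parameter pairs, by one of energy no larger, with the SAME
near-defective and far-defective fractions, equilibrated for every pair of the list. Proof: finite descent —
each violating move keeps the fractions (`descent_step`) and lowers `e` by more than `min εᵢρᵢ / #motif`; the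
energy floor of item 0714 bounds the number of steps (induction on the integer part of `(e − floor)/q`). -/
theorem stub_frozenDescent : ∀ P : (PeriodicConfiguration 3), ∀ l : List (ℝ × ℝ), (∀ p ∈ l, 0 < p.1 ∧ 0 < p.2) →
    ∃ P' : (PeriodicConfiguration 3), e P' ≤ e P ∧ ndFrac P' = ndFrac P ∧ fdFrac P' = fdFrac P ∧
      ∀ p ∈ l, Equilibrated p.1 p.2 P' := by
  intro P l hl
  obtain ⟨δ, hδ, hδl⟩ := exists_min_prod l hl
  obtain ⟨B, hB⟩ := exists_floor
  set n : ℕ := P.motif.card with hn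
  have hnpos : (0 : ℝ) < n := motif_card_pos P
  set q : ℝ := δ / n with hq
  have hqpos : 0 < q := div_pos hδ hnpos
  have key : ∀ k : ℕ, ∀ P₁ : (PeriodicConfiguration 3), P₁.motif.card = n → e P₁ < B + k * q →
      ∃ P' : (PeriodicConfiguration 3), e P' ≤ e P₁ ∧ ndFrac P' = ndFrac P₁ ∧ fdFrac P' = fdFrac P₁ ∧
        ∀ p ∈ l, Equilibrated p.1 p.2 P' := by
    intro k
    induction k with
    | zero =>
      intro P₁ _ hlt
      simp only [Nat.cast_zero, zero_mul, add_zero] at hlt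
      linarith [hB P₁]
    | succ k ih =>
      intro P₁ hc hlt
      by_cases hall : ∀ p ∈ l, Equilibrated p.1 p.2 P₁
      · exact ⟨P₁, le_rfl, rfl, rfl, hall⟩
      · push Not at hall
        obtain ⟨p, hp, hne⟩ := hall
        obtain ⟨P₂, hc₂, hn₂, hf₂, hgain⟩ := descent_step (hl p hp).1 (hl p hp).2 hne
        rw [hc] at hgain
        have hgain' : q < e P₁ - e P₂ := by
          rw [hq, div_lt_iff₀ hnpos]
          nlinarith [hδl p hp]
        have hlt₂ : e P₂ < B + k * q := by
          push_cast at hlt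
          linarith
        obtain ⟨P', h1, h2, h3, h4⟩ := ih P₂ (hc₂.trans hc) hlt₂
        exact ⟨P', by linarith, h2.trans hn₂, h3.trans hf₂, h4⟩
  obtain ⟨k, hk⟩ := exists_nat_gt ((e P - B) / q)
  have hP : e P < B + k * q := by
    rw [div_lt_iff₀ hqpos] at hk
    linarith
  exact key k P rfl hP

end Summit.AtomisticToContinuum.Crystallization.Theorems.ReggeStarCoercivityPeriodicStarCoercivity

end
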